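import Mathlib.Analysis.Real.Sqrt
import Mathlib.Analysis.Complex.Polynomial.Basic
import Literature.NumberTheory.QuadraticForms.HilbertSymbol
import HarnessLib

/-!
# The Hilbert symbol at the infinite places

Topic `NumberTheory/QuadraticForms`; namespace `Literature`. Companion ("proofs") file of
`HilbertSymbol.lean`; every declaration is a fully proved theorem. O'Meara (§63B) defines the
Hilbert symbol `(a, b)_𝔭` also over a complete archimedean field (`𝔭` real or complex); its
values there are elementary:

* `hilbertSymbol_map_ringEquiv` : invariance of `(a, b)_F` under field isomorphisms;
* `Real.hilbertSymbol_eq_one_iff`, `Real.hilbertSymbol_eq_neg_one_iff` : over `ℝ`,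
  `(a, b) = 1` iff `a > 0` or `b > 0`, i.e. `(a, b) = -1` iff `a ≤ 0` and `b ≤ 0` (for
  `a b ≠ 0`: iff `a < 0` and `b < 0` — the real quaternion algebra `(a, b / ℝ)` is Hamilton's
  `ℍ` iff `a, b < 0`);
* `hilbertSymbol_eq_one_of_isAlgClosed` : over an algebraically closed field (e.g. `ℂ`),
  `(a, b) = 1` as soon as `a ≠ 0` or `b ≠ 0`;
* for a number field `K`, `a b ∈ K` and an infinite place `w` with completion `K_w = w.Completion`
  (Mathlib `NumberField.InfinitePlace.Completion`, with `K_w ≃+* ℝ` resp. `≃+* ℂ`):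
  `hilbertSymbol_completion_eq_one_of_isComplex` (`(a, b)_w = 1` at complex `w` for `a ≠ 0`),
  `hilbertSymbol_completion_eq_one_iff_of_isReal` and
  `hilbertSymbol_completion_eq_neg_one_iff_of_isReal` (at a real `w` with real embedding `σ_w`:
  `(a, b)_w = -1` iff `σ_w(a) ≤ 0` and `σ_w(b) ≤ 0`), and the resulting description
  `setOf_hilbertSymbol_completion_eq_neg_one` of the set of infinite places with `(a, b)_w = -1`
  (`a b ≠ 0`) as the real places at which both `a` and `b` are negative — the archimedean factor
  of Hilbert's product formula `∏_v (a, b)_v = 1` (O'Meara 71:18; `hilbertReciprocity`), and the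
  infinite ramification `Ram_∞ ℍ[K,a,b]` of a quaternion algebra (Vignéras, LNM 800, Ch. III §1
  Exemple).

## References

* O. T. O'Meara, *Introduction to quadratic forms*, Grundlehren 117, Springer (1963), §63B
  (PDF p. 168: the symbol over "any complete archimedean field").
* J.-P. Serre, *A Course in Arithmetic*, GTM 7, Springer (1973), Ch. III §1, Thm. 1 (the case
  `k = ℝ`: `(a, b)_∞ = -1` iff `a, b < 0`).
-/

noncomputable section

open NumberField

namespace Literature.NumberTheory.QuadraticForms

/-! ### Transport along field isomorphisms -/

section RingEquiv

variable {F F' : Type*} [Field F] [Field F']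

/-- The Hilbert symbol is invariant under field isomorphisms: `(e a, e b)_{F'} = (a, b)_F`.
[folklore] -/
theorem hilbertSymbol_map_ringEquiv (e : F ≃+* F') (a b : F) :
    hilbertSymbol F' (e a) (e b) = hilbertSymbol F a b := by
  have key : (∃ x y : F', e a * x ^ 2 + e b * y ^ 2 = 1) ↔ ∃ x y : F, a * x ^ 2 + b * y ^ 2 = 1 := by
    constructor
    · rintro ⟨x, y, h⟩
      refine ⟨e.symm x, e.symm y, e.injective ?_⟩
      simpa [map_add, map_mul, map_pow] using h
    · rintro ⟨x, y, h⟩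
      refine ⟨e x, e y, ?_⟩
      simpa [map_add, map_mul, map_pow] using congrArg e h
  by_cases h : ∃ x y : F, a * x ^ 2 + b * y ^ 2 = 1
  · rw [(hilbertSymbol_eq_one_iff _ _).2 (key.2 h), (hilbertSymbol_eq_one_iff _ _).2 h]
  · rw [(hilbertSymbol_eq_neg_one_iff _ _).2 fun h' ↦ h (key.1 h'),
      (hilbertSymbol_eq_neg_one_iff _ _).2 h]

end RingEquiv

/-! ### The real and the algebraically closed case -/

/-- Over `ℝ`: `(a, b)_ℝ = 1` iff `a > 0` or `b > 0` (if `a > 0` take `x = 1/√a`, `y = 0`; if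
`a, b ≤ 0` then `a x² + b y² ≤ 0 < 1`). O'Meara §63B; Serre, *A Course in Arithmetic*, III.1
Thm. 1. [folklore] -/
theorem Real.hilbertSymbol_eq_one_iff (a b : ℝ) : hilbertSymbol ℝ a b = 1 ↔ 0 < a ∨ 0 < b := by
  rw [Literature.NumberTheory.QuadraticForms.hilbertSymbol_eq_one_iff]
  constructor
  · rintro ⟨x, y, h⟩
    by_contra hab
    push Not at hab
    nlinarith [mul_le_mul_of_nonpos_left (sq_nonneg x) hab.1,
      mul_le_mul_of_nonpos_left (sq_nonneg y) hab.2]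
  · rintro (ha | hb)
    · refine ⟨(Real.sqrt a)⁻¹, 0, ?_⟩
      rw [inv_pow, Real.sq_sqrt ha.le, mul_inv_cancel₀ ha.ne']
      ring
    · refine ⟨0, (Real.sqrt b)⁻¹, ?_⟩
      rw [inv_pow, Real.sq_sqrt hb.le, mul_inv_cancel₀ hb.ne']
      ring

/-- Over `ℝ`: `(a, b)_ℝ = -1` iff `a ≤ 0` and `b ≤ 0` (so, for `a b ≠ 0`, iff `a < 0` and
`b < 0`: Hamilton's quaternions). [folklore] -/
theorem Real.hilbertSymbol_eq_neg_one_iff (a b : ℝ) :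
    hilbertSymbol ℝ a b = -1 ↔ a ≤ 0 ∧ b ≤ 0 := by
  rw [← hilbertSymbol_ne_one_iff, Ne, Real.hilbertSymbol_eq_one_iff]
  push Not
  exact Iff.rfl

/-- Over an algebraically closed field (e.g. `ℂ`), `(a, b) = 1` whenever `a ≠ 0` or `b ≠ 0`
(`a` is a non-zero square). O'Meara §63B (complex complete fields). [folklore] -/
theorem hilbertSymbol_eq_one_of_isAlgClosed {F : Type*} [Field F] [IsAlgClosed F] {a b : F}
    (hab : a ≠ 0 ∨ b ≠ 0) : hilbertSymbol F a b = 1 := by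
  rcases hab with ha | hb
  · obtain ⟨z, hz⟩ := IsAlgClosed.exists_pow_nat_eq a two_pos
    exact hilbertSymbol_eq_one_of_isSquare ⟨z, by rw [← hz]; ring⟩ ha b
  · obtain ⟨z, hz⟩ := IsAlgClosed.exists_pow_nat_eq b two_pos
    rw [hilbertSymbol_comm]
    exact hilbertSymbol_eq_one_of_isSquare ⟨z, by rw [← hz]; ring⟩ hb a

/-! ### Infinite places of a number field -/

section InfinitePlace

variable {K : Type*} [Field K] {w : InfinitePlace K}

/-- At a complex place `w`, `(a, b)_w = 1` for `a ≠ 0` or `b ≠ 0`: `K_w ≃+* ℂ` (Mathlib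
`Completion.ringEquivComplexOfIsComplex`) is algebraically closed. [folklore] -/
theorem hilbertSymbol_completion_eq_one_of_isComplex (hw : w.IsComplex) {a b : K}
    (hab : a ≠ 0 ∨ b ≠ 0) :
    hilbertSymbol w.Completion (algebraMap K _ a) (algebraMap K _ b) = 1 := by
  let e := InfinitePlace.Completion.ringEquivComplexOfIsComplex hw
  rw [← hilbertSymbol_map_ringEquiv e]
  refine hilbertSymbol_eq_one_of_isAlgClosed ?_
  rcases hab with ha | hb
  · exact Or.inl ((_root_.map_ne_zero e).2 ((_root_.map_ne_zero _).2 ha))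
  · exact Or.inr ((_root_.map_ne_zero e).2 ((_root_.map_ne_zero _).2 hb))

/-- The isomorphism `K_w ≃+* ℝ` at a real place extends the real embedding `σ_w` of `K`
(Mathlib `Completion.extensionEmbeddingOfIsReal_coe`, restated for `algebraMap K K_w`).
[folklore] -/
theorem ringEquivRealOfIsReal_algebraMap (hw : w.IsReal) (a : K) :
    InfinitePlace.Completion.ringEquivRealOfIsReal hw (algebraMap K w.Completion a) =
      InfinitePlace.embedding_of_isReal hw a := by
  rw [InfinitePlace.Completion.ringEquivRealOfIsReal_apply,
    InfinitePlace.Completion.algebraMap_apply]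
  simp only [InfinitePlace.Completion.extensionEmbeddingOfIsReal_coe, WithAbs.equiv_apply]

/-- At a real place `w` with real embedding `σ_w`: `(a, b)_w = 1` iff `σ_w(a) > 0` or
`σ_w(b) > 0` (transport along `K_w ≃+* ℝ` and `Real.hilbertSymbol_eq_one_iff`). [folklore] -/
theorem hilbertSymbol_completion_eq_one_iff_of_isReal (hw : w.IsReal) (a b : K) :
    hilbertSymbol w.Completion (algebraMap K _ a) (algebraMap K _ b) = 1 ↔
      0 < InfinitePlace.embedding_of_isReal hw a ∨ 0 < InfinitePlace.embedding_of_isReal hw b := by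
  rw [← hilbertSymbol_map_ringEquiv (InfinitePlace.Completion.ringEquivRealOfIsReal hw),
    ringEquivRealOfIsReal_algebraMap, ringEquivRealOfIsReal_algebraMap,
    Real.hilbertSymbol_eq_one_iff]

/-- At a real place `w`: `(a, b)_w = -1` iff `σ_w(a) ≤ 0` and `σ_w(b) ≤ 0` (for `a b ≠ 0`: iff
both are negative at `w`, i.e. `K_w ⊗ (a, b) ≅` Hamilton's quaternions; Vignéras Ch. III §1
Exemple, O'Meara §63B). [folklore] -/
theorem hilbertSymbol_completion_eq_neg_one_iff_of_isReal (hw : w.IsReal) (a b : K) :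
    hilbertSymbol w.Completion (algebraMap K _ a) (algebraMap K _ b) = -1 ↔
      InfinitePlace.embedding_of_isReal hw a ≤ 0 ∧ InfinitePlace.embedding_of_isReal hw b ≤ 0 := by
  rw [← hilbertSymbol_ne_one_iff, Ne, hilbertSymbol_completion_eq_one_iff_of_isReal hw]
  push Not
  exact Iff.rfl

/-- The infinite places `w` of a number field with `(a, b)_w = -1`, for `a b ≠ 0`, are exactly the
real places at which `a` and `b` are both negative (complex places never occur). This is the
archimedean part of the product `∏_v (a, b)_v` of Hilbert reciprocity (O'Meara 71:18) and the set
`Ram_∞` of the quaternion algebra `(a, b / K)` (Vignéras Ch. III §1 Exemple). [folklore] -/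
theorem setOf_hilbertSymbol_completion_eq_neg_one {a b : K} (ha : a ≠ 0) (hb : b ≠ 0) :
    {w : InfinitePlace K |
        hilbertSymbol w.Completion (algebraMap K _ a) (algebraMap K _ b) = -1} =
      {w : InfinitePlace K | ∃ hw : w.IsReal,
        InfinitePlace.embedding_of_isReal hw a < 0 ∧ InfinitePlace.embedding_of_isReal hw b < 0} := by
  ext w
  simp only [Set.mem_setOf_eq]
  rcases w.isReal_or_isComplex with hw | hw
  · rw [hilbertSymbol_completion_eq_neg_one_iff_of_isReal hw]
    have ha' : InfinitePlace.embedding_of_isReal hw a ≠ 0 := (_root_.map_ne_zero _).2 ha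
    have hb' : InfinitePlace.embedding_of_isReal hw b ≠ 0 := (_root_.map_ne_zero _).2 hb
    constructor
    · rintro ⟨h1, h2⟩
      exact ⟨hw, lt_of_le_of_ne h1 ha', lt_of_le_of_ne h2 hb'⟩
    · rintro ⟨hw', h1, h2⟩
      exact ⟨(Subsingleton.elim hw hw') ▸ h1.le, (Subsingleton.elim hw hw') ▸ h2.le⟩
  · rw [hilbertSymbol_completion_eq_one_of_isComplex hw (Or.inl ha)]
    constructor
    · intro h; norm_num at h
    · rintro ⟨hw', -, -⟩
      exact absurd hw' (InfinitePlace.not_isReal_iff_isComplex.2 hw)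

/-- In particular only finitely many (indeed at most the real) infinite places have
`(a, b)_w = -1`; the set is contained in the set of real places. [folklore] -/
theorem isReal_of_hilbertSymbol_completion_eq_neg_one {a b : K} (hab : a ≠ 0 ∨ b ≠ 0)
    (h : hilbertSymbol w.Completion (algebraMap K _ a) (algebraMap K _ b) = -1) : w.IsReal := by
  by_contra hw
  rw [InfinitePlace.not_isReal_iff_isComplex] at hw
  rw [hilbertSymbol_completion_eq_one_of_isComplex hw hab] at h
  norm_num at h

end InfinitePlace

end Literature.NumberTheory.QuadraticForms
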